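import Summits.BirchSwinnertonDyer.Rank1Residual.Additive.LocalSubgroupTransport
import HarnessLib

/-!
# Route `SignedLowerHalves`, crux L `SmallImageLowerHalfBothSigns` (stmt-BirchSwinnertonDyer-23599), line `rtt_w3` v11 — brick D3-W, CONCRETE HALF,
# part 3 (memo `Lines/rtt_w3-MEMO-D3c-w3g17.md` §6 (W3)(ii)): the transport `transportHom : Λ' → Gal(K̄_v/K_n·K_v)` of the local base-change square
# is ONTO — every element `τ'` of the `K`-side local group `localSubgroupOfEmb H' ι'` is `ι₂ h ι₂⁻¹` for `h := ι₂⁻¹ τ' ι₂ ∈ Γ_E`, which restricts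
# into `H ⊓ galRange K` (so the coset spaces `Λ'_{m+1}/Λ'_n` and `Gal(K̄_v/K_{m+1}K_v)/Gal(K̄_v/K_nK_v)` correspond, the input of the trace
# comparison (W3)).

Width seat `bsd-line-slh-p3-w3` g17 under LEAD `cruxlead-stmt-BirchSwinnertonDyer-23599` (cell `bsd-ssimc`; `--supports stmt-BirchSwinnertonDyer-23599 --as helper`).
THEOREMS ONLY (no definition, no named fact, no instance, no `sorry`); data of `Rank1Residual/Additive/LocalSubgroupTransport` (cell b2b) plus
`hι₂` (`ι₂` is `E`-linear) and `hH'H : res(H') ⊆ H` (in D3-W: `H' = Γ_{K_n} = res⁻¹ Γ_{ℚ_n}`). Nothing at the completions; BSD / crux L NOT proved.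

* `transportAut_symm_fixes` — `τ' ∈ Γ_{E'}` fixes `ι₂(E)`, so `h := ι₂⁻¹ τ' ι₂` is an `E`-automorphism (`transportAut ι₂.symm`).
* `transportAut_transportAut_symm` — `ι₂ h ι₂⁻¹ = τ'`.
* `resGalOfEmb_transportAut_symm` — `res_ι h = res_{K/k}(res_{ι'} τ')` (from the tree's `resGal_resGalOfEmb_transportAut`).
* ★ `exists_transportHom_eq` — SURJECTIVITY: for `τ' ∈ localSubgroupOfEmb H' ι'` there is `h ∈ localSubgroupOfEmb (H ⊓ galRange K) ι` with
  `transportHom h = τ'` (for the transport built on `H ⊓ galRange K`, any `hfix`).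

References: [SerreGaloisCohomology1997] II §1.1 (embeddings of separable closures and the induced maps on Galois groups).
-/

set_option autoImplicit false
set_option linter.dupNamespace false -- D-0017: single-problem summit, the namespace repeats the problem name by design
noncomputable section

open scoped Classical

universe u

namespace Summit.BirchSwinnertonDyer.BirchSwinnertonDyer.Theorems.SmallImageCharSignedSelmer

open Literature.NumberTheory.EllipticCurves Literature.NumberTheory.GaloisRepresentations Field
  Summit.BirchSwinnertonDyer.Rank1Residual.Additive.LocalTransport

section Surj

variable {k : Type u} [Field k] (K : Type u) [Field K] [Algebra k K] [Algebra.IsAlgebraic k K]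
  {E : Type u} [Field E] [Algebra k E] {E' : Type u} [Field E'] [Algebra K E'] [Algebra E E']
  (ι : AlgebraicClosure k →ₐ[k] AlgebraicClosure E) (ι₂ : AlgebraicClosure E ≃+* AlgebraicClosure E')
  (ι' : AlgebraicClosure K →ₐ[K] AlgebraicClosure E')
  (hcompat : ∀ z : AlgebraicClosure k, ι' (closureEmb (K := k) K z) = ι₂ (ι z))
  (hι₂ : ∀ a : E, ι₂ (algebraMap E (AlgebraicClosure E) a) = algebraMap E' (AlgebraicClosure E') (algebraMap E E' a))

include hι₂ in
omit [Algebra k K] [Algebra.IsAlgebraic k K] [Algebra k E] [Algebra K E'] in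
/-- An `E'`-automorphism `τ'` of `Ē'` fixes `ι₂(E)` (`ι₂` is `E`-linear and `E → E' → Ē'`), i.e. the fixing hypothesis of `transportAut ι₂.symm τ'`.
[cite: SerreGaloisCohomology1997, II §1.1] -/
theorem transportAut_symm_fixes (τ' : absoluteGaloisGroup E') (y : E) :
    (show AlgebraicClosure E' ≃ₐ[E'] AlgebraicClosure E' from τ') (ι₂.symm.symm (algebraMap E (AlgebraicClosure E) y)) =
      ι₂.symm.symm (algebraMap E (AlgebraicClosure E) y) := by
  rw [RingEquiv.symm_symm, hι₂]
  exact (show AlgebraicClosure E' ≃ₐ[E'] AlgebraicClosure E' from τ').commutes _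

omit [Algebra k K] [Algebra.IsAlgebraic k K] [Algebra k E] [Algebra K E'] [Algebra E E'] in
/-- `ι₂ (ι₂⁻¹ τ' ι₂) ι₂⁻¹ = τ'`. [cite: SerreGaloisCohomology1997, II §1.1] -/
theorem transportAut_transportAut_symm (τ' : absoluteGaloisGroup E')
    (hh : ∀ y : E, (show AlgebraicClosure E' ≃ₐ[E'] AlgebraicClosure E' from τ') (ι₂.symm.symm (algebraMap E (AlgebraicClosure E) y)) =
      ι₂.symm.symm (algebraMap E (AlgebraicClosure E) y))
    (hh' : ∀ y : E', (show AlgebraicClosure E ≃ₐ[E] AlgebraicClosure E from transportAut ι₂.symm τ' hh)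
      (ι₂.symm (algebraMap E' (AlgebraicClosure E') y)) = ι₂.symm (algebraMap E' (AlgebraicClosure E') y)) :
    transportAut ι₂ (transportAut ι₂.symm τ' hh) hh' = τ' := by
  apply AlgEquiv.ext
  intro x
  rw [transportAut_apply, transportAut_apply, RingEquiv.symm_symm, RingEquiv.apply_symm_apply, RingEquiv.apply_symm_apply]

include hcompat in
omit [Algebra E E'] in
/-- `res_ι (ι₂⁻¹ τ' ι₂) = res_{K/k} (res_{ι'} τ')`. [cite: SerreGaloisCohomology1997, II §1.1] -/
theorem resGalOfEmb_transportAut_symm (τ' : absoluteGaloisGroup E')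
    (hh : ∀ y : E, (show AlgebraicClosure E' ≃ₐ[E'] AlgebraicClosure E' from τ') (ι₂.symm.symm (algebraMap E (AlgebraicClosure E) y)) =
      ι₂.symm.symm (algebraMap E (AlgebraicClosure E) y))
    (hh' : ∀ y : E', (show AlgebraicClosure E ≃ₐ[E] AlgebraicClosure E from transportAut ι₂.symm τ' hh)
      (ι₂.symm (algebraMap E' (AlgebraicClosure E') y)) = ι₂.symm (algebraMap E' (AlgebraicClosure E') y)) :
    resGalOfEmb ι (transportAut ι₂.symm τ' hh) = resGal (K := k) K (resGalOfEmb ι' τ') := by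
  have h := resGal_resGalOfEmb_transportAut K ι ι₂ ι' hcompat (transportAut ι₂.symm τ' hh) hh'
  rw [transportAut_transportAut_symm ι₂ τ' hh hh'] at h
  exact h.symm

variable (H : Subgroup (absoluteGaloisGroup k)) (H' : Subgroup (absoluteGaloisGroup K))
  (hHH' : ∀ τ : absoluteGaloisGroup K, resGal (K := k) K τ ∈ H ⊓ galRange (K := k) K → τ ∈ H')
  (hH'H : ∀ τ : absoluteGaloisGroup K, τ ∈ H' → resGal (K := k) K τ ∈ H)
  (hfix : ∀ h : absoluteGaloisGroup E, resGalOfEmb ι h ∈ H ⊓ galRange (K := k) K → ∀ y : E',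
    (show AlgebraicClosure E ≃ₐ[E] AlgebraicClosure E from h) (ι₂.symm (algebraMap E' (AlgebraicClosure E') y)) =
      ι₂.symm (algebraMap E' (AlgebraicClosure E') y))

include hcompat hι₂ hH'H in
/-- ★ **The transport `Λ' → localSubgroupOfEmb H' ι'` is onto.** Every `τ'` of the `K`-side local group is `transportHom h` for
`h := ι₂⁻¹ τ' ι₂ ∈ localSubgroupOfEmb (H ⊓ galRange K) ι` (`h` fixes `E` since `ι₂` is `E`-linear; `res_ι h = res_{K/k}(res_{ι'} τ')` lies in
`res(H') ⊆ H` and in `galRange K`). In D3-W (`H = Γ_{ℚ_{m}}`, `H' = Γ_{K_{m}}`): `Gal(K̄_v/K_m·K_v) = transportHom(Λ'_m)`, so `K`-tower traces are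
sums over `Λ'`-cosets. [cite: SerreGaloisCohomology1997, II §1.1] -/
theorem exists_transportHom_eq (τ' : localSubgroupOfEmb H' ι') :
    ∃ h : localSubgroupOfEmb (H ⊓ galRange (K := k) K) ι, transportHom K (H ⊓ galRange (K := k) K) H' hHH' ι ι₂ ι' hcompat hfix h = τ' := by
  set h₀ : absoluteGaloisGroup E := transportAut ι₂.symm (τ' : absoluteGaloisGroup E') (transportAut_symm_fixes ι₂ hι₂ τ') with hh₀
  have hres : resGalOfEmb ι h₀ = resGal (K := k) K (resGalOfEmb ι' (τ' : absoluteGaloisGroup E')) := by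
    refine resGalOfEmb_transportAut_symm K ι ι₂ ι' hcompat _ _ fun y ↦ ?_
    -- `ι₂ h₀ ι₂⁻¹ = τ'` fixes `E'`
    rw [transportAut_apply, RingEquiv.symm_symm, RingEquiv.apply_symm_apply]
    apply ι₂.injective
    rw [RingEquiv.apply_symm_apply, RingEquiv.apply_symm_apply]
    exact (show AlgebraicClosure E' ≃ₐ[E'] AlgebraicClosure E' from (τ' : absoluteGaloisGroup E')).commutes y
  have hmem : h₀ ∈ localSubgroupOfEmb (H ⊓ galRange (K := k) K) ι := by
    rw [mem_localSubgroupOfEmb_iff, hres, Subgroup.mem_inf]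
    exact ⟨hH'H _ τ'.2, (mem_galRange_iff K _).2 ⟨_, rfl⟩⟩
  refine ⟨⟨h₀, hmem⟩, Subtype.ext ?_⟩
  rw [coe_transportHom_apply]
  change transportAut ι₂ h₀ (hfix h₀ hmem) = (τ' : absoluteGaloisGroup E')
  clear_value h₀
  subst hh₀
  exact transportAut_transportAut_symm ι₂ (τ' : absoluteGaloisGroup E') (transportAut_symm_fixes ι₂ hι₂ τ') _

end Surj

end Summit.BirchSwinnertonDyer.BirchSwinnertonDyer.Theorems.SmallImageCharSignedSelmer

end
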